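import Summits.ABC.ABC.Theses.RibetTakahashiSplit

/-!
# Glue r2 → r2F: `ManyPrimeValuationProduct → ManyPrimeValuationProductFrey`

Closes the support item `stmt-ABC-15151` (`ManyPrimeFreyOfManyPrime`) of route
`route-ABC-RibetTakahashiSplit`. The whole-class many-prime valuation-product bound r2
(`ManyPrimeValuationProduct`: `T(E) := ∏_{p ∥ N} ord_p(Δ_min(E)) ≤ C_ε N^ε` for every `E/ℚ`
semistable away from `2` with `≥ 4` odd multiplicative primes) is the STRONGER statement: the
rev-6 crux r2F (`ManyPrimeValuationProductFrey`) is the same bound restricted to curves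
ℚ-isomorphic to a twisted Frey–Hellegouarch curve `freyCurve (d a) (d b)`, i.e. r2 with one
extra hypothesis. The proof drops that hypothesis (same constant `C_ε`).
-/

-- `Summit.<Summit>.<Problem>`: for the single-conjunct summit `ABC` the duplicate `ABC.ABC` is mandated.
set_option linter.dupNamespace false

namespace Summit.ABC.ABC.Theorems

/-- **Glue r2 → r2F** (item `stmt-ABC-15151`): the whole-class many-prime valuation-product bound
`ManyPrimeValuationProduct` implies its restriction `ManyPrimeValuationProductFrey` to the
(twisted) Frey–Hellegouarch class — forget the Frey-model hypothesis; the constant is unchanged. -/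
theorem manyPrimeFreyOfManyPrime_proof :
    Summit.ABC.ABC.Theses.RibetTakahashiSplit.ManyPrimeFreyOfManyPrime := by
  unfold Summit.ABC.ABC.Theses.RibetTakahashiSplit.ManyPrimeFreyOfManyPrime
  intro hMany ε hε
  obtain ⟨C, hC⟩ := hMany ε hε
  refine ⟨C, ?_⟩
  intro W _ hss _ h4
  exact hC W hss h4

end Summit.ABC.ABC.Theorems
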